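import Mathlib.NumberTheory.LocalField.Basic
import Mathlib.RingTheory.Frobenius
import Literature.NumberTheory.GaloisRepresentations.LocalField
import Literature.NumberTheory.GaloisRepresentations.AbsGaloisGroup
import Literature.NumberTheory.GaloisRepresentations.IntegralGaloisAction
import HarnessLib

-- provenance: harness21/H21/H21/Prelude/GalRep/LocalGaloisGroup.lean @ c2c710d (interim HEAD d8f2665); M5 mechanical rewrite
/-!
# The local absolute Galois group: inertia and Frobenius powers (trunk GalRep, item C4)

Let `F` be a non-archimedean local field (`[IsNonarchimedeanLocalField F]`, Mathlib), with
valuation ring `𝒪[F]`, maximal ideal `𝓂[F]`, residue field `𝓀[F]` of cardinality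
`q = Literature.IsNonarchimedeanLocalField.residueFieldCard F`, absolute Galois group
`Γ_F = Field.absoluteGaloisGroup F` and `S = Literature.absIntegers 𝒪[F] F`, the integral closure of
`𝒪[F]` in `F̄ = AlgebraicClosure F` (the valuation ring of `F̄`).  Since `F` is complete, hence
henselian, there is a *unique* prime `𝔓` of `S` above `𝓂[F]`; we define it canonically, without
any choice and without any `sorry`, as the radical of `𝓂[F] S`:

* `Literature.IsNonarchimedeanLocalField.absMaximalIdeal F := ((𝓂[F]).map (algebraMap 𝒪[F] S)).radical`,
  with the (sorried) theorems `absMaximalIdeal_isMaximal`,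
  `primesOver_maximalIdeal_eq_singleton`, `smul_absMaximalIdeal`, `under_absMaximalIdeal`.

Consequently the local inertia group and Frobenius powers carry no parameter:

* `Literature.absInertia F : Subgroup Γ_F := (absMaximalIdeal F).inertia Γ_F` (Mathlib's
  `Ideal.inertia`), normal and closed, and `D_𝔓 = Γ_F`
  (`decompositionSubgroup_absMaximalIdeal_eq_top`);
* `Literature.IsAbsArithFrob σ := IsArithFrobAt 𝒪[F] σ (absMaximalIdeal F)` (Mathlib's arithmetic
  Frobenius predicate, `Mathlib/RingTheory/Frobenius.lean`);
* `Literature.IsFrobPow σ n` (`n : ℤ`): `σ` acts on `S ⧸ 𝔓` as the `n`-th power of the arithmetic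
  Frobenius `x ↦ x ^ q`; the API `isFrobPow_zero_iff_mem_absInertia`,
  `isFrobPow_one_iff_isAbsArithFrob`, `IsFrobPow.mul`, `IsFrobPow.inv`, `IsFrobPow.unique`,
  `exists_isAbsArithFrob`;
* compatibility with a finite extension `E/F` through `Literature.absGaloisRestrict F E`:
  `absInertia_map_absGaloisRestrict_le` and `IsFrobPow.absGaloisRestrict` (degree is multiplied
  by the residue degree).

These are the prerequisites of the Weil group `W_F` (item C7).

Frobenius sign convention (OUTLINE §1, restated): `IsArithFrobAt` / `IsAbsArithFrob` is the
*arithmetic* Frobenius `x ↦ x ^ q (mod 𝔓)` and `IsFrobPow` counts it as `+1`; the geometric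
Frobenius (Deligne) has `IsFrobPow σ (-1)`.  The exponent `q` in `IsFrobPow` is
`residueFieldCard F = Nat.card 𝓀[F]` (item C1), whereas Mathlib's `IsArithFrobAt R σ Q` uses
`Nat.card (R ⧸ Q.under R)`; the two agree by `under_absMaximalIdeal` (a theorem), whence
`isFrobPow_one_iff_isAbsArithFrob`.

Mathlib search: Mathlib has `IsArithFrobAt`, `Ideal.inertia`, `MulAction.stabilizer`,
`Ideal.primesOver`, `IsNonarchimedeanLocalField`, `ValuativeExtension`, but no absolute inertia
group / Weil-group notions for local fields (grep for `inertia`, `Frob`, `Weil` in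
`Mathlib/NumberTheory/LocalField`, `Mathlib/FieldTheory`, `Mathlib/RingTheory`); nothing here
duplicates a Mathlib declaration.

Sources: J.-P. Serre, *Local Fields* (1979), Ch. I §7–§8, Ch. II §2–§3 (henselian extension of
the valuation, inertia); J. Tate, *Number theoretic background* (Corvallis 1979), §1.4
(`W_F`, `I_F`, Frobenius, (1.4.1)–(1.4.6)); J. Neukirch, *Algebraic Number Theory* (1999),
Ch. II §6 (henselian fields), Ch. V §1; P. Deligne, *Les constantes des équations
fonctionnelles des fonctions L* (Antwerp II, 1973), §2.2, §8.

Design choices.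
* Rule of OUTLINE §4.9 (review 6): `absMaximalIdeal` is data (a radical); its maximality and all
  facts needing henselianity are `theorem … := by sorry`.  **No definition in this file uses a
  sorried fact**: `absInertia`, `IsAbsArithFrob`, `IsFrobPow` only mention the ideal itself
  (`#print axioms` on each definition shows no `sorryAx`).
* `IsFrobPow` is defined by cases on `ℤ` (`Int.ofNat` / `Int.negSucc`) with `σ⁻¹` for negative
  exponents, so that it is a plain elementwise congruence and needs no residue-field structure on
  `S ⧸ 𝔓`.
* The finite-extension compatibility takes `[ValuativeExtension F E]` (the valuation of `E`
  restricts to that of `F`) and the residue degree as an explicit natural number `f` with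
  `q_E = q_F ^ f`, avoiding an `Algebra 𝒪[F] 𝒪[E]` instance that Mathlib does not provide.
* Namespaces: `absMaximalIdeal` and its lemmas live in `Literature.IsNonarchimedeanLocalField`
  (mirroring Mathlib's class name, as in `Literature.Prelude.GalRep.LocalField`); the group-theoretic
  notions live directly in `Literature`.
-/

noncomputable section

open scoped Pointwise Valued
open ValuativeRel Field

namespace Literature.NumberTheory.GaloisRepresentations

namespace IsNonarchimedeanLocalField

variable (F : Type*) [Field F] [ValuativeRel F] [TopologicalSpace F] [IsNonarchimedeanLocalField F]

/-- The canonical maximal ideal `𝔓` of `S = absIntegers 𝒪[F] F` (integral closure of `𝒪[F]` in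
`F̄`), defined as the radical of the extended ideal `𝓂[F] S`.  Since `F` is henselian, `S` is
the valuation ring of the unique extension of the valuation to `F̄` and `𝔓` is its maximal
ideal, the unique prime of `S` above `𝓂[F]` (`absMaximalIdeal_isMaximal`,
`primesOver_maximalIdeal_eq_singleton`).  This definition uses no `sorry`.
Ref: Serre, *Local Fields*, Ch. II §2, Prop. 3 and Ch. I §8; Neukirch, *Algebraic Number
Theory*, Ch. II (6.2). [folklore] -/
def absMaximalIdeal : Ideal (absIntegers 𝒪[F] F) :=
  ((𝓂[F]).map (algebraMap 𝒪[F] (absIntegers 𝒪[F] F))).radical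

/-- `𝔓 = absMaximalIdeal F` is a maximal ideal of `S` (henselianity of `F`: the valuation extends
uniquely to `F̄`, and `S` is local with maximal ideal `𝔓`).
Ref: Serre, *Local Fields*, Ch. II §2, Prop. 3; Neukirch, *Algebraic Number Theory*,
Ch. II (4.8) and (6.2) (the valuation of a complete field extends uniquely to any algebraic
extension, with valuation ring the integral closure of the valuation ring).
[cite: NeukirchANT1999, Ch. II Thm. (6.2) with (4.8)] -/
def absMaximalIdeal_isMaximal : Prop :=
  (absMaximalIdeal F).IsMaximal

/-- `𝔓 = absMaximalIdeal F` lies over `𝓂[F]`: `𝔓 ∩ 𝒪[F] = 𝓂[F]`.  (Needed to compare Mathlib's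
exponent `Nat.card (𝒪[F] ⧸ 𝔓.under 𝒪[F])` in `IsArithFrobAt` with `residueFieldCard F`.)
Ref: Serre, *Local Fields*, Ch. II §2, Prop. 3; Neukirch, *Algebraic Number Theory*, Ch. II (4.8),
(6.2) (the extended valuation restricts to `v`).
[cite: NeukirchANT1999, Ch. II Thm. (6.2) with (4.8)] -/
def under_absMaximalIdeal : Prop :=
  (absMaximalIdeal F).under 𝒪[F] = 𝓂[F]

/-- `𝔓 = absMaximalIdeal F` is the unique prime of `S` lying over `𝓂[F]`:
`(𝓂[F]).primesOver S = {𝔓}`.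
Ref: Serre, *Local Fields*, Ch. II §2, Prop. 3 and Cor. 2; Neukirch, *Algebraic Number Theory*,
Ch. II (6.2) (uniqueness of the extension), (8.1). [cite: NeukirchANT1999, Ch. II Thm. (6.2)] -/
def primesOver_maximalIdeal_eq_singleton : Prop :=
  (𝓂[F]).primesOver (absIntegers 𝒪[F] F) = {absMaximalIdeal F}

/-- The whole absolute Galois group fixes `𝔓 = absMaximalIdeal F`: `σ • 𝔓 = 𝔓` for every
`σ ∈ Gal(F̄/F)` (uniqueness of the prime above `𝓂[F]`).
Ref: Serre, *Local Fields*, Ch. II §2, Cor. 2 and Cor. 3 to Prop. 3 (conjugate elements have the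
same valuation); Neukirch, *Algebraic Number Theory*, Ch. II (6.2).
[cite: SerreLocalFields1979, Ch. II §2 Cor. 3 to Prop. 3] -/
def smul_absMaximalIdeal : Prop :=
  ∀ (σ : absoluteGaloisGroup F),
    σ • absMaximalIdeal F = absMaximalIdeal F

/-- The exponent in Mathlib's `IsArithFrobAt 𝒪[F] σ 𝔓`, namely `#(𝒪[F] ⧸ 𝔓 ∩ 𝒪[F])`, is the
residue cardinality `q_F = residueFieldCard F`.
Ref: Serre, *Local Fields*, Ch. II §2. [folklore] -/
def card_quotient_under_absMaximalIdeal : Prop :=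
  Nat.card (𝒪[F] ⧸ (absMaximalIdeal F).under 𝒪[F]) = residueFieldCard F

/- interim proof relied on results that are now named facts (D-0014); demoted to a fact by the M5 import, proof preserved:
:= by
  rw [under_absMaximalIdeal]
  rfl
-/

end IsNonarchimedeanLocalField

open GaloisRepresentations.IsNonarchimedeanLocalField

section Inertia

variable (F : Type*) [Field F] [ValuativeRel F] [TopologicalSpace F] [IsNonarchimedeanLocalField F]

/-- The (absolute) *inertia group* `I_F ≤ Gal(F̄/F)` of a non-archimedean local field: the
inertia subgroup (Mathlib's `Ideal.inertia`) of the canonical prime `𝔓 = absMaximalIdeal F`,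
i.e. `{σ | ∀ x ∈ S, σ • x - x ∈ 𝔓}`.  No parameter and no `sorry` is involved.
Ref: Serre, *Local Fields*, Ch. I §7–§8 and Ch. IV §1; Tate, *Number theoretic background*
(Corvallis 1979), (1.4.1). [cite: TateCorvallis1979, §1.4 (1.4.1)] -/
def absInertia : Subgroup (absoluteGaloisGroup F) :=
  (absMaximalIdeal F).inertia (absoluteGaloisGroup F)

variable {F} in
/-- Membership in the inertia group: `σ ∈ I_F ↔ ∀ x ∈ S, σ • x - x ∈ 𝔓`.
Ref: Serre, *Local Fields*, Ch. I §7. [folklore] -/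
theorem mem_absInertia_iff {σ : absoluteGaloisGroup F} :
    σ ∈ absInertia F ↔ ∀ x : absIntegers 𝒪[F] F, σ • x - x ∈ absMaximalIdeal F :=
  Iff.rfl

/-- The decomposition group of `𝔓 = absMaximalIdeal F` is all of `Gal(F̄/F)` (the prime above
`𝓂[F]` is unique).  Ref: Serre, *Local Fields*, Ch. II §2, Cor. 2 to Prop. 3. [folklore] -/
def decompositionSubgroup_absMaximalIdeal_eq_top : Prop :=
  (absMaximalIdeal F).decompositionSubgroup (absoluteGaloisGroup F) = ⊤

/- interim proof relied on results that are now named facts (D-0014); demoted to a fact by the M5 import, proof preserved: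
:= by
  refine (Subgroup.eq_top_iff' _).mpr fun σ => ?_
  exact Ideal.mem_decompositionSubgroup_iff.mpr (smul_absMaximalIdeal F σ)
-/

/-- The inertia group `I_F` is a normal subgroup of `Gal(F̄/F)` (it is normal in the
decomposition group, which is everything).
Ref: Serre, *Local Fields*, Ch. I §7, Prop. 20; Tate, Corvallis 1979, (1.4.1).
[cite: TateCorvallis1979, §1.4 (1.4.1)] -/
def absInertia_normal : Prop :=
  (absInertia F).Normal

/- interim proof relied on results that are now named facts (D-0014); demoted to a fact by the M5 import, proof preserved:
:= by
  refine ⟨fun σ hσ τ x => ?_⟩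
  have h : τ • (σ • τ⁻¹ • x - τ⁻¹ • x) ∈ τ • absMaximalIdeal F :=
    Ideal.smul_mem_pointwise_smul _ _ _ (hσ (τ⁻¹ • x))
  rwa [smul_absMaximalIdeal, smul_sub, smul_inv_smul, ← mul_smul, ← mul_smul] at h
-/

/-- The inertia group `I_F` is closed in `Gal(F̄/F)` for the Krull topology
(`Literature.NumberTheory.GaloisRepresentations.absIntegers.isClosed_inertia`).
Ref: Serre, *Local Fields*, Ch. IV §1; Neukirch, *Algebraic Number Theory*, Ch. IV §1. [folklore] -/
def isClosed_absInertia : Prop :=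
  IsClosed (absInertia F : Set (absoluteGaloisGroup F))

/- interim proof relied on results that are now named facts (D-0014); demoted to a fact by the M5 import, proof preserved:
:=
  absIntegers.isClosed_inertia (R := 𝒪[F]) (K := F) (absMaximalIdeal F)
-/

end Inertia

/-! ### Arithmetic Frobenius and Frobenius powers -/

section Frobenius

variable {F : Type*} [Field F] [ValuativeRel F] [TopologicalSpace F] [IsNonarchimedeanLocalField F]

/-- `σ ∈ Gal(F̄/F)` is an *(absolute) arithmetic Frobenius* of the non-archimedean local field
`F`: Mathlib's `IsArithFrobAt 𝒪[F] σ 𝔓` at the canonical prime `𝔓 = absMaximalIdeal F`, i.e.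
`σ • x ≡ x ^ q (mod 𝔓)` for all `x ∈ S`, where `q = #(𝒪[F] ⧸ 𝔓 ∩ 𝒪[F])` (`= q_F` by
`card_quotient_under_absMaximalIdeal`).  Sign convention of OUTLINE §1: this is the arithmetic
Frobenius, counted as `+1` by `IsFrobPow`.
Ref: Serre, *Local Fields*, Ch. I §8; Tate, *Number theoretic background* (Corvallis 1979),
(1.4.1); Deligne, *Les constantes des équations fonctionnelles* (1973), §2.2.
[cite: TateCorvallis1979, §1.4 (1.4.1)] -/
def IsAbsArithFrob (σ : absoluteGaloisGroup F) : Prop :=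
  IsArithFrobAt 𝒪[F] σ (absMaximalIdeal F)

/-- Unfolded form of `IsAbsArithFrob` with the exponent `q_F = residueFieldCard F`:
`σ • x - x ^ q_F ∈ 𝔓` for all `x ∈ S`.
Ref: Serre, *Local Fields*, Ch. I §8. [folklore] -/
def isAbsArithFrob_iff : Prop :=
  ∀ {σ : absoluteGaloisGroup F},
    IsAbsArithFrob σ ↔
      ∀ x : absIntegers 𝒪[F] F, σ • x - x ^ residueFieldCard F ∈ absMaximalIdeal F

/- interim proof relied on results that are now named facts (D-0014); demoted to a fact by the M5 import, proof preserved: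
:= by
  rw [← card_quotient_under_absMaximalIdeal F]
  rfl
-/

/-- `IsFrobPow σ n` (`n : ℤ`): `σ ∈ Gal(F̄/F)` acts on `S` modulo `𝔓 = absMaximalIdeal F` as the
`n`-th power of the arithmetic Frobenius `x ↦ x ^ q_F`, `q_F = residueFieldCard F = #𝓀[F]`.
For `n ≥ 0` this is `∀ x ∈ S, σ • x - x ^ (q_F ^ n) ∈ 𝔓`; for `n = -(m+1) < 0` it is
`∀ x ∈ S, σ⁻¹ • x - x ^ (q_F ^ (m+1)) ∈ 𝔓`.  Thus `IsFrobPow σ 0 ↔ σ ∈ I_F`, arithmetic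
Frobenius elements have `n = 1` and geometric Frobenius elements `n = -1` (OUTLINE §1 sign
convention; Tate's `W_F` is `{σ | ∃ n, IsFrobPow σ n}`, item C7).  The definition only uses the
ideal `𝔓`, no sorried fact.
Ref: Tate, *Number theoretic background* (Corvallis 1979), (1.4.1)–(1.4.4); Deligne, *Les
constantes des équations fonctionnelles* (1973), §2.2.4.
[cite: TateCorvallis1979, §1.4 (1.4.1)–(1.4.4)] -/
def IsFrobPow (σ : absoluteGaloisGroup F) : ℤ → Prop
  | Int.ofNat n =>
      ∀ x : absIntegers 𝒪[F] F, σ • x - x ^ residueFieldCard F ^ n ∈ absMaximalIdeal F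
  | Int.negSucc n =>
      ∀ x : absIntegers 𝒪[F] F, σ⁻¹ • x - x ^ residueFieldCard F ^ (n + 1) ∈ absMaximalIdeal F

/-- Unfolding lemma for `IsFrobPow` at a non-negative exponent.
Ref: Tate, Corvallis 1979, (1.4.1). [cite: TateCorvallis1979, §1.4 (1.4.1)] -/
theorem isFrobPow_natCast_iff {σ : absoluteGaloisGroup F} {n : ℕ} :
    IsFrobPow σ n ↔
      ∀ x : absIntegers 𝒪[F] F, σ • x - x ^ residueFieldCard F ^ n ∈ absMaximalIdeal F :=
  Iff.rfl

/-- Unfolding lemma for `IsFrobPow` at a negative exponent `Int.negSucc n = -(n+1)`.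
Ref: Tate, Corvallis 1979, (1.4.1). [cite: TateCorvallis1979, §1.4 (1.4.1)] -/
theorem isFrobPow_negSucc_iff {σ : absoluteGaloisGroup F} {n : ℕ} :
    IsFrobPow σ (Int.negSucc n) ↔
      ∀ x : absIntegers 𝒪[F] F,
        σ⁻¹ • x - x ^ residueFieldCard F ^ (n + 1) ∈ absMaximalIdeal F :=
  Iff.rfl

/-- `IsFrobPow σ (-n) ↔ IsFrobPow σ⁻¹ n` for `n : ℕ`.
Ref: Tate, Corvallis 1979, (1.4.1). [cite: TateCorvallis1979, §1.4 (1.4.1)] -/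
theorem isFrobPow_neg_natCast_iff {σ : absoluteGaloisGroup F} {n : ℕ} :
    IsFrobPow σ (-(n : ℤ)) ↔ IsFrobPow σ⁻¹ n := by
  cases n with
  | zero =>
    change (∀ x, _ ∈ _) ↔ (∀ x, _ ∈ _)
    simp only [pow_zero, pow_one]
    exact ((absMaximalIdeal F).inertia (absoluteGaloisGroup F)).inv_mem_iff.symm
  | succ n => rfl

/-- `IsFrobPow σ 0 ↔ σ ∈ I_F`: the elements acting trivially modulo `𝔓` form the inertia group.
Ref: Tate, *Number theoretic background* (Corvallis 1979), (1.4.1).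
[cite: TateCorvallis1979, §1.4 (1.4.1)] -/
theorem isFrobPow_zero_iff_mem_absInertia {σ : absoluteGaloisGroup F} :
    IsFrobPow σ 0 ↔ σ ∈ absInertia F := by
  change (∀ x, _ ∈ _) ↔ _
  simp only [pow_zero, pow_one]
  rfl

/-- `IsFrobPow σ 1 ↔ IsAbsArithFrob σ`: exponent-`1` Frobenius powers are exactly Mathlib's
arithmetic Frobenius elements at `𝔓` (uses `under_absMaximalIdeal` to identify the exponents
`q_F` and `#(𝒪[F] ⧸ 𝔓 ∩ 𝒪[F])`).
Ref: Serre, *Local Fields*, Ch. I §8; Tate, Corvallis 1979, (1.4.1).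
[cite: TateCorvallis1979, §1.4 (1.4.1)] -/
def isFrobPow_one_iff_isAbsArithFrob : Prop :=
  ∀ {σ : absoluteGaloisGroup F},
    IsFrobPow σ 1 ↔ IsAbsArithFrob σ

/- interim proof relied on results that are now named facts (D-0014); demoted to a fact by the M5 import, proof preserved:
:= by
  rw [isAbsArithFrob_iff]
  change (∀ x, _ ∈ _) ↔ _
  simp only [pow_one]
-/

/-- An arithmetic Frobenius is a Frobenius power of exponent `1`.
Ref: Tate, Corvallis 1979, (1.4.1). [cite: TateCorvallis1979, §1.4 (1.4.1)] -/
def IsAbsArithFrob.isFrobPow : Prop :=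
  ∀ {σ : absoluteGaloisGroup F} (h : IsAbsArithFrob σ),
    IsFrobPow σ 1

/- interim proof relied on results that are now named facts (D-0014); demoted to a fact by the M5 import, proof preserved:
:=
  isFrobPow_one_iff_isAbsArithFrob.mpr h
-/

/-- The identity is a Frobenius power of exponent `0`.
Ref: Tate, Corvallis 1979, (1.4.1). [cite: TateCorvallis1979, §1.4 (1.4.1)] -/
theorem IsFrobPow.one : IsFrobPow (1 : absoluteGaloisGroup F) 0 :=
  isFrobPow_zero_iff_mem_absInertia.mpr (one_mem _)

/-- Frobenius powers multiply: exponents add (`W_F → ℤ` is a homomorphism).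
Ref: Tate, *Number theoretic background* (Corvallis 1979), (1.4.1)–(1.4.4).
[cite: TateCorvallis1979, §1.4 (1.4.1)–(1.4.4)] -/
def IsFrobPow.mul : Prop :=
  ∀ {σ τ : absoluteGaloisGroup F} {m n : ℤ} (hσ : IsFrobPow σ m) (hτ : IsFrobPow τ n),
    IsFrobPow (σ * τ) (m + n)

/-- The inverse of a Frobenius power of exponent `n` is one of exponent `-n`.
Ref: Tate, *Number theoretic background* (Corvallis 1979), (1.4.1).
[cite: TateCorvallis1979, §1.4 (1.4.1)] -/
theorem IsFrobPow.inv {σ : absoluteGaloisGroup F} {n : ℤ} (hσ : IsFrobPow σ n) :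
    IsFrobPow σ⁻¹ (-n) := by
  cases n with
  | ofNat k => rw [Int.ofNat_eq_natCast, isFrobPow_neg_natCast_iff, inv_inv]; exact hσ
  | negSucc k => exact hσ

/-- The exponent of a Frobenius power is unique: the residue field `S ⧸ 𝔓` is an algebraic
closure of `𝓀[F]`, on which the Frobenius `x ↦ x ^ q_F` has infinite order.  Hence
`deg : W_F → ℤ` is well defined.
Ref: Tate, *Number theoretic background* (Corvallis 1979), (1.4.1)–(1.4.4); Serre, *Local
Fields*, Ch. XIII §5, App. [cite: TateCorvallis1979, §1.4 (1.4.1)–(1.4.4)] -/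
def IsFrobPow.unique : Prop :=
  ∀ {σ : absoluteGaloisGroup F} {m n : ℤ} (hm : IsFrobPow σ m) (hn : IsFrobPow σ n),
    m = n

/-- Two Frobenius powers with the same exponent differ by an element of the inertia group.
Ref: Tate, *Number theoretic background* (Corvallis 1979), (1.4.1).
[cite: TateCorvallis1979, §1.4 (1.4.1)] -/
def IsFrobPow.mul_inv_mem_absInertia : Prop :=
  ∀ {σ τ : absoluteGaloisGroup F} {n : ℤ} (hσ : IsFrobPow σ n) (hτ : IsFrobPow τ n),
    σ * τ⁻¹ ∈ absInertia F

/- interim proof relied on results that are now named facts (D-0014); demoted to a fact by the M5 import, proof preserved: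
:= by
  rw [← isFrobPow_zero_iff_mem_absInertia, ← add_neg_cancel n]
  exact hσ.mul hτ.inv
-/

/-- Multiplying a Frobenius power by an element of inertia (on the left) does not change the
exponent.  Ref: Tate, *Number theoretic background* (Corvallis 1979), (1.4.1).
[cite: TateCorvallis1979, §1.4 (1.4.1)] -/
def IsFrobPow.inertia_mul : Prop :=
  ∀ {σ τ : absoluteGaloisGroup F} {n : ℤ} (hτ : τ ∈ absInertia F) (hσ : IsFrobPow σ n),
    IsFrobPow (τ * σ) n

/- interim proof relied on results that are now named facts (D-0014); demoted to a fact by the M5 import, proof preserved: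
:= by
  simpa using (isFrobPow_zero_iff_mem_absInertia.mpr hτ).mul hσ
-/

/-- Existence of an arithmetic Frobenius in `Gal(F̄/F)`: `Gal(F̄/F) → Gal(𝔽̄_q/𝔽_q)` is
surjective (`D_𝔓 = Gal(F̄/F)` surjects onto the Galois group of the residue extension).
Ref: Serre, *Local Fields*, Ch. I §7, Prop. 20 and Ch. III §5; Tate, Corvallis 1979, (1.4.1).
[cite: TateCorvallis1979, §1.4 (1.4.1)] -/
def exists_isAbsArithFrob : Prop :=
  ∃ σ : absoluteGaloisGroup F, IsAbsArithFrob σ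

/-- Every integer is the exponent of some Frobenius power (powers of an arithmetic Frobenius);
equivalently `deg : W_F → ℤ` is surjective.
Ref: Tate, *Number theoretic background* (Corvallis 1979), (1.4.1)–(1.4.4).
[cite: TateCorvallis1979, §1.4 (1.4.1)–(1.4.4)] -/
def exists_isFrobPow : Prop :=
  ∀ (n : ℤ),
    ∃ σ : absoluteGaloisGroup F, IsFrobPow σ n

end Frobenius

/-! ### Compatibility with finite extensions `E/F` -/

section Restrict

variable (F E : Type*) [Field F] [ValuativeRel F] [TopologicalSpace F]
  [IsNonarchimedeanLocalField F] [Field E] [ValuativeRel E] [TopologicalSpace E]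
  [IsNonarchimedeanLocalField E] [Algebra F E] [FiniteDimensional F E] [ValuativeExtension F E]

/-- For a finite extension `E/F` of non-archimedean local fields (the valuation of `E` extending
that of `F`), the restriction `Gal(Ē/E) → Gal(F̄/F)` (`Literature.absGaloisRestrict F E`) maps the
inertia group `I_E` into `I_F` (indeed `I_E = I_F ∩ Gal(Ē/E)`).
Ref: Serre, *Local Fields*, Ch. I §7, Prop. 22; Tate, *Number theoretic background*
(Corvallis 1979), (1.4.5). [cite: TateCorvallis1979, §1.4 (1.4.5)] -/
def absInertia_map_absGaloisRestrict_le : Prop :=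
  (absInertia E).map (absGaloisRestrict F E).toMonoidHom ≤ absInertia F

variable {E} in
/-- Degree scaling under restriction: if `σ ∈ Gal(Ē/E)` is a Frobenius power of exponent `n`
for `E` and `f` is the residue degree of `E/F` (`q_E = q_F ^ f`), then the restriction of `σ`
to `F̄` is a Frobenius power of exponent `f * n` for `F` (`x ^ q_E = (x ^ q_F) ^ f`-fold
iterate).  This is Tate's `‖w‖_E = ‖w‖_F` for `w ∈ W_E ⊆ W_F`.
Ref: Tate, *Number theoretic background* (Corvallis 1979), (1.4.5)–(1.4.6); Serre, *Local
Fields*, Ch. I §8. [cite: TateCorvallis1979, §1.4 (1.4.5)–(1.4.6)] -/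
def IsFrobPow.absGaloisRestrict : Prop :=
  ∀ {σ : absoluteGaloisGroup E} {n : ℤ} (hσ : IsFrobPow σ n) (f : ℕ)
    (hf : residueFieldCard E = residueFieldCard F ^ f),
    IsFrobPow (Literature.NumberTheory.GaloisRepresentations.absGaloisRestrict F E σ) (f * n)

end Restrict

end Literature.NumberTheory.GaloisRepresentations
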